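import Summits.CriticalPhenomena.PercolationContinuityZ3.Theorems.PercShatteringRaceNearLinearTwoClusterDecayStubSuperCritPairConnLower
import Summits.CriticalPhenomena.PercolationContinuityZ3.Theorems.PercShatteringRaceNearLinearTwoClusterDecayStubAspectOfTwoArmBdry
import Summits.CriticalPhenomena.PercolationContinuityZ3.Theorems.PercShatteringRaceNearLinearTwoClusterDecayStubCritTwoArmImproved
import Summits.CriticalPhenomena.PercolationContinuityZ3.Theorems.PercShatteringRaceNearLinearTwoClusterDecayStubCritPairConnLower
import Summits.CriticalPhenomena.PercolationContinuityZ3.Theorems.NearLinearTwoClusterDecay.Negative.Structure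
import HarnessLib

/-!
# Crux `PercShatteringRace.NearLinearTwoClusterDecay` (stmt-CriticalPhenomena-5785) — certificate U₁ at EVERY parameter:
# two distinct in-box crossing clusters at aspect exponent `> 44` have vanishing probability for all `p ∈ (0,1)` (bond `ℤ³`)

Helper file of the line `pair-decay-long-arms-dense` (lead c6, wave 2); lands with `--supports stmt-CriticalPhenomena-5785`.
It composes the landed frontier stubs W4 `Theorems.stub_superCritPairConnLower` (`P_p(a ↔ b inside Λ_{2n}) ≥ c n^{-12}` on
`Λ_n²` for every `p ≥ p_c`: `φ_p(Λ_m) ≥ 1` + Cerf Lemma 6.1 chaining), W5 `Theorems.stub_aspectOfTwoArmBdry` (the lossy step at a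
general parameter with Cerf's BOUNDARY-pair count `4 + 6 + e`: a pair bound `c n^{-e}` and a two-arms exponent `κ` give decay of
the crux event at every exponent `A > 1` with `κA > 10 + e`), W2 `Theorems.stub_critTwoArmImproved` (`∃ κ > 1/2` at `p_c`) and the
AKN bound `P_p(edgeTwoArms i m) ≤ κ₀ (1 + log m)/√m` (`AKN.exists_real_edgeTwoArms_le`) into:

* `superCritTwoClusterDecay_of_gt_44` — for every `p ∈ [p_c, 1)` and every `A > 44`, the crux event of `(Λ_n, Λ_{⌈n^A⌉})` under
  `P_p` tends to `0` (Cerf 2015 Cor 7.3-type statement for bond `ℤ³`, unconditional: no hypothesis on `θ`);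
* `critAtExponent_of_gt_44`, `exists_critAtExponent_lt_44`, `critAtExponent_of_ge_44` — at `p_c`: `Negative.AtExponent A` for
  every `A ≥ 44` and for some `A < 44` (improving the `48` of `…CritFrontier.lean` / `…CritFrontierStrict.lean` to Cerf's own count
  `(4d−2+2d(d−1))/κ = 22/κ`; print, site: `22 · 23/12 = 42.17` with Cerf's Thm 1.1 exponent);
* `twoClusterDecay_of_gt_44` — for EVERY `p ∈ (0,1)` and every `A > 44` the crux event decays (subcritical branch by sharpness,
  `Negative.subcritical_crossing_decay`); so the only parameter at which two-cluster decay at a polynomial aspect is in doubt below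
  exponent `44` is `p_c` itself… and there the crux asserts it at `7/6`.

## References

* R. Cerf, Ann. Probab. 43 (2015) 2458–2480, arXiv:1306.3105: Thm 1.1, Thm 1.2, Lemma 6.1, Lemma 7.1, Cor 7.2, Cor 7.3 [Cerf2015].
* M. Aizenman, H. Kesten, C. M. Newman, Comm. Math. Phys. 111 (1987) 505–531 [AizenmanKestenNewmanCMP1987].
* H. Duminil-Copin, V. Tassion, Enseign. Math. 62 (2016) 199–206 [DuminilCopinTassionEM2016]; Comm. Math. Phys. 343 (2016) (sharpness).
-/

noncomputable section

namespace Summit.CriticalPhenomena.PercolationContinuityZ3.Theorems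

namespace NearLinearTwoClusterDecay.CritFrontier

open MeasureTheory Filter Topology
open Literature.Probability.LatticeModels Literature.Probability.Percolation
open Summit.CriticalPhenomena.PercolationContinuityZ3.Theorems.NearLinearTwoClusterDecay.Negative

/-- `1 + log m ≤ (1 + 1/ε) m^ε` for `m ≥ 1`, `ε > 0` (`log m ≤ m^ε/ε`). [folklore] -/
theorem one_add_log_le_rpow' {ε m : ℝ} (hε : 0 < ε) (hm : 1 ≤ m) :
    1 + Real.log m ≤ (1 + 1 / ε) * m ^ ε := by
  have h1 : Real.log m ≤ m ^ ε / ε := Real.log_le_rpow_div (by linarith) hε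
  have h2 : 1 ≤ m ^ ε := Real.one_le_rpow hm hε.le
  have h3 : (1 + 1 / ε) * m ^ ε = m ^ ε + m ^ ε / ε := by ring
  rw [h3]
  exact add_le_add h2 h1

/-- **The AKN two-arms bound as an exponent, at any `p ∈ (0,1)`**: for every `κ < 1/2` there is `C` with
`P_p(edgeTwoArms i m) ≤ C m^{-κ}` (`AKN.exists_real_edgeTwoArms_le` on `[δ, 1−δ] ∋ p`, `δ = min (min p (1−p)) (1/2)`, and
`1 + log m ≤ (1 + 1/ε) m^ε`). [cite: Cerf2015, Prop 5.2] -/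
theorem twoArm_of_lt_half_at (p : unitInterval) (hp0 : 0 < (p : ℝ)) (hp1 : (p : ℝ) < 1) {κ : ℝ} (hκ : κ < 1 / 2) :
    ∃ C : ℝ, ∀ i : Fin 3, ∀ m : ℕ, 1 ≤ m →
      (bondPercolation (zdGraph 3) p).real (AKN.edgeTwoArms i m) ≤ C * (m : ℝ) ^ (-κ) := by
  set δ : ℝ := min (min (p : ℝ) (1 - p)) (1 / 2) with hδ
  have hδ0 : 0 < δ := lt_min (lt_min hp0 (by linarith)) (by norm_num)
  have hδh : δ ≤ 1 / 2 := min_le_right _ _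
  have hδp : δ ≤ (p : ℝ) := (min_le_left _ _).trans (min_le_left _ _)
  have hδp' : (p : ℝ) ≤ 1 - δ := by
    have : δ ≤ 1 - p := (min_le_left _ _).trans (min_le_right _ _)
    linarith
  obtain ⟨κ₀, _, h⟩ := AKN.exists_real_edgeTwoArms_le (d := 3) (by norm_num) hδ0 hδh
  set ε : ℝ := 1 / 2 - κ with hε
  have hε0 : 0 < ε := by rw [hε]; linarith
  refine ⟨κ₀ * (1 + 1 / ε), fun i m hm => ?_⟩
  have hm1 : (1 : ℝ) ≤ m := by exact_mod_cast hm
  have hm0 : (0 : ℝ) < m := by linarith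
  have hb := h p hδp hδp' i m hm
  have hlog := one_add_log_le_rpow' hε0 hm1
  have hsqrt : Real.sqrt (m : ℝ) = (m : ℝ) ^ (1 / 2 : ℝ) := Real.sqrt_eq_rpow _
  calc (bondPercolation (zdGraph 3) p).real (AKN.edgeTwoArms i m)
      ≤ κ₀ * (1 + Real.log m) / Real.sqrt m := hb
    _ ≤ κ₀ * ((1 + 1 / ε) * (m : ℝ) ^ ε) / Real.sqrt m := by gcongr
    _ = κ₀ * (1 + 1 / ε) * ((m : ℝ) ^ ε / (m : ℝ) ^ (1 / 2 : ℝ)) := by rw [hsqrt]; ring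
    _ = κ₀ * (1 + 1 / ε) * (m : ℝ) ^ (-κ) := by
        rw [← Real.rpow_sub hm0]
        congr 2
        rw [hε]; ring

/-- `0 < p_c(ℤ³) < 1` (bond), real form. [folklore] -/
theorem criticalProb_three_pos_lt_one :
    0 < criticalProb (zdGraph 3) (0 : Site 3) ∧ criticalProb (zdGraph 3) (0 : Site 3) < 1 :=
  Grimmett1999_criticalProb_pos_lt_one_holds 3 (by norm_num)

/-- **Two-cluster decay above aspect exponent `44` at every `p ∈ [p_c, 1)`** (Cerf 2015 Cor 7.3-type, bond `ℤ³`, no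
hypothesis on `θ(p)`): W4 (pair bound `c n^{-12}`, `e = 12`) and the AKN exponent `κ = (1/2 + 22/A)/2 < 1/2` in W5
(`κA = A/4 + 11 > 22`). [cite: Cerf2015, Cor 7.3] -/
theorem superCritTwoClusterDecay_of_gt_44 (p : unitInterval) (hpc : criticalProb (zdGraph 3) (0 : Site 3) ≤ (p : ℝ))
    (hp1 : (p : ℝ) < 1) {A : ℝ} (hA : 44 < A) :
    Tendsto (fun n : ℕ => (bondPercolation (zdGraph 3) p).real
      {ω | ∃ x ∈ box 3 n, ∃ x' ∈ box 3 n, ∃ y ∈ innerBoundary (zdGraph 3) (box 3 ⌈(n : ℝ) ^ A⌉₊),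
        ∃ y' ∈ innerBoundary (zdGraph 3) (box 3 ⌈(n : ℝ) ^ A⌉₊),
          ω ∈ openConnIn ↑(box 3 ⌈(n : ℝ) ^ A⌉₊) x y ∧ ω ∈ openConnIn ↑(box 3 ⌈(n : ℝ) ^ A⌉₊) x' y' ∧
            ω ∉ openConnIn ↑(box 3 ⌈(n : ℝ) ^ A⌉₊) x x'}) atTop (𝓝 0) := by
  have hp0 : 0 < (p : ℝ) := criticalProb_three_pos_lt_one.1.trans_le hpc
  have hA0 : 0 < A := by linarith
  set κ : ℝ := (1 / 2 + 22 / A) / 2 with hκ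
  have h22A : 22 / A < 1 / 2 := by rw [div_lt_iff₀ hA0]; linarith
  have hκlt : κ < 1 / 2 := by rw [hκ]; linarith
  have hκ0 : 0 < κ := by rw [hκ]; positivity
  have hκA : 10 + 12 < κ * A := by
    have : κ * A = A / 4 + 11 := by rw [hκ]; field_simp; ring
    rw [this]; linarith
  exact stub_aspectOfTwoArmBdry p hp0 12 (by norm_num) (stub_superCritPairConnLower p hpc) κ hκ0
    (twoArm_of_lt_half_at p hp0 hp1 hκlt) A (by linarith) hκA

/-- **At `p_c`: `AtExponent A` for every `A > 44`, unconditionally** (bond Cerf 2015 Thm 1.2 with the AKN exponent and Cerf's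
own boundary-pair count; improves the `48` of `critAtExponent_of_gt_48`). [cite: Cerf2015, Thm 1.2] -/
theorem critAtExponent_of_gt_44 {A : ℝ} (hA : 44 < A) : NearLinearTwoClusterDecay.Negative.AtExponent A := by
  have h := superCritTwoClusterDecay_of_gt_44 (criticalProbI 3) (by rw [coe_criticalProbI])
    (by rw [coe_criticalProbI]; exact criticalProb_three_pos_lt_one.2) hA
  exact h

/-- **At `p_c` the threshold is strictly below `44`** (bond Cerf Thm 1.1 at `p_c`, W2: `κ₀ > 1/2`, in W5 with W1:
`A = (22/κ₀ + 44)/2`). [cite: Cerf2015, Thm 1.1 and Thm 1.2] -/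
theorem exists_critAtExponent_lt_44 : ∃ A : ℝ, A < 44 ∧ NearLinearTwoClusterDecay.Negative.AtExponent A := by
  obtain ⟨κ₀, hκ₀, hT⟩ := stub_critTwoArmImproved stub_critPairConnLower
  have hκ0 : 0 < κ₀ := by linarith
  have h22 : 22 / κ₀ < 44 := by rw [div_lt_iff₀ hκ0]; linarith
  have h0 : 0 < 22 / κ₀ := by positivity
  have hp0 : 0 < ((criticalProbI 3 : unitInterval) : ℝ) := by rw [coe_criticalProbI]; exact criticalProb_three_pos_lt_one.1
  refine ⟨(22 / κ₀ + 44) / 2, by linarith, ?_⟩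
  refine stub_aspectOfTwoArmBdry (criticalProbI 3) hp0 12 (by norm_num) stub_critPairConnLower κ₀ hκ0 hT _ (by linarith) ?_
  have : κ₀ * ((22 / κ₀ + 44) / 2) = 11 + 22 * κ₀ := by field_simp; ring
  rw [this]; linarith

/-- **At `p_c`: `AtExponent A` for every `A ≥ 44`** (endpoint by monotonicity, `Negative.atExponent_mono`). [cite: Cerf2015, Thm 1.2] -/
theorem critAtExponent_of_ge_44 {A : ℝ} (hA : 44 ≤ A) : NearLinearTwoClusterDecay.Negative.AtExponent A := by
  obtain ⟨A', hA', h⟩ := exists_critAtExponent_lt_44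
  by_cases h1 : 1 ≤ A'
  · exact atExponent_mono h1 (by linarith) h
  · exact absurd h (not_atExponent_of_le_one (by push Not at h1; linarith))

/-- For `A > 1`, eventually `2n ≤ ⌈n^A⌉₊`. [folklore] -/
theorem eventually_two_mul_le_ceil_rpow {A : ℝ} (hA : 1 < A) : ∀ᶠ n : ℕ in atTop, 2 * n ≤ ⌈(n : ℝ) ^ A⌉₊ := by
  have hev : ∀ᶠ u : ℕ in atTop, (2 : ℝ) ≤ (u : ℝ) ^ (A - 1) :=
    ((tendsto_rpow_atTop (by linarith : 0 < A - 1)).comp tendsto_natCast_atTop_atTop).eventually_ge_atTop 2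
  filter_upwards [hev, eventually_ge_atTop 1] with n hn hn1
  have hU : (0 : ℝ) < n := by exact_mod_cast hn1
  have key : (2 * n : ℝ) ≤ (n : ℝ) ^ A := by
    have hsplit : (n : ℝ) ^ A = (n : ℝ) ^ (A - 1) * n := by
      have e : A = (A - 1) + 1 := by ring
      conv_lhs => rw [e]
      rw [Real.rpow_add hU, Real.rpow_one]
    rw [hsplit]
    nlinarith
  have : ((2 * n : ℕ) : ℝ) ≤ (⌈(n : ℝ) ^ A⌉₊ : ℝ) := by push_cast; exact key.trans (Nat.le_ceil _)
  exact_mod_cast this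

/-- **Two-cluster decay above aspect exponent `44` at EVERY `p < 1`**: below `p_c` by sharpness (exponential one-arm
decay, `Negative.subcritical_crossing_decay` + `twoClusterEvt ⊆ crossingEvt`), from `p_c` on by `superCritTwoClusterDecay_of_gt_44`.
So the crux family's phenomenon — two distinct in-box crossing clusters at a polynomial aspect — is excluded above exponent `44`
at every parameter; at `p_c` the crux asserts it down to `7/6`. [cite: Cerf2015, Cor 7.3] -/
theorem twoClusterDecay_of_gt_44 (p : unitInterval) (hp1 : (p : ℝ) < 1) {A : ℝ} (hA : 44 < A) :
    Tendsto (fun n : ℕ => (bondPercolation (zdGraph 3) p).real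
      {ω | ∃ x ∈ box 3 n, ∃ x' ∈ box 3 n, ∃ y ∈ innerBoundary (zdGraph 3) (box 3 ⌈(n : ℝ) ^ A⌉₊),
        ∃ y' ∈ innerBoundary (zdGraph 3) (box 3 ⌈(n : ℝ) ^ A⌉₊),
          ω ∈ openConnIn ↑(box 3 ⌈(n : ℝ) ^ A⌉₊) x y ∧ ω ∈ openConnIn ↑(box 3 ⌈(n : ℝ) ^ A⌉₊) x' y' ∧
            ω ∉ openConnIn ↑(box 3 ⌈(n : ℝ) ^ A⌉₊) x x'}) atTop (𝓝 0) := by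
  rcases lt_or_ge (p : ℝ) (criticalProb (zdGraph 3) (0 : Site 3)) with hlt | hge
  · -- subcritical: single-crossing decay already, at any outer scale ≥ 2n
    have h := subcritical_crossing_decay p hlt (m := fun n => ⌈(n : ℝ) ^ A⌉₊)
      (eventually_two_mul_le_ceil_rpow (by linarith))
    refine squeeze_zero' (Eventually.of_forall fun n => measureReal_nonneg)
      (Eventually.of_forall fun n => measureReal_mono (twoClusterEvt_subset_crossingEvt _ _)) h
  · exact superCritTwoClusterDecay_of_gt_44 p hge hp1 hA

/-- **Status of the crux family after wave 2** (for the planner): at `p_c` decay FAILS at every exponent `≤ 1` and HOLDS at every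
exponent `≥ 44` and at some exponent `< 44`; at every other `p ∈ (0,1)` it holds at every exponent `> 44` (indeed at every
exponent `> 1` below `p_c`); the crux is the instance `p = p_c`, `A = 7/6`. [folklore] -/
theorem atExponent_status_44 :
    (∀ A : ℝ, A ≤ 1 → ¬ NearLinearTwoClusterDecay.Negative.AtExponent A) ∧
    (∀ A : ℝ, 44 ≤ A → NearLinearTwoClusterDecay.Negative.AtExponent A) ∧
    (∃ A : ℝ, A < 44 ∧ NearLinearTwoClusterDecay.Negative.AtExponent A) ∧
    (Theses.PercShatteringRace.NearLinearTwoClusterDecay ↔ NearLinearTwoClusterDecay.Negative.AtExponent ((7 : ℝ) / 6)) :=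
  ⟨fun _ hA => not_atExponent_of_le_one hA, fun _ hA => critAtExponent_of_ge_44 hA, exists_critAtExponent_lt_44,
    nearLinearTwoClusterDecay_iff⟩

end NearLinearTwoClusterDecay.CritFrontier

end Summit.CriticalPhenomena.PercolationContinuityZ3.Theorems

end
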